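import Mathlib.NumberTheory.NumberField.CMField
import Literature.NumberTheory.NumberFields.NormOneTorusRealApproximation
import HarnessLib

/-!
# Liu 2021, Def. 4.12: `μ`-admissible elements of `E^{×,−}` — definition, the `μ ↔ μ^c` symmetry, and
# existence by weak approximation (proved)

Yifeng Liu, *Fourier–Jacobi cycles and arithmetic relative trace formula* (with an appendix by Chao Li and
Yihang Zhu), Cambridge J. Math. **9** (2021), no. 1, 1–147 = arXiv:2102.11518 [Liu2021], §4.2 (held extraction
`paper:arxiv-2102.11518`, chunk p0020 L44–51; author's TeX `FJcycle.tex` ll. 2102–2111, label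
`de:admissible_collection`).

AS PRINTED (Def. 4.12): "In an adèlic oscillator triple `(μ,ε,χ)`, we say that `ε` is *`μ`-admissible* if there
exists some `e ∈ E^{×−}` such that • `ε_v = e N_{E_v/F_v} E_v^×` for every nonarchimedean place `v` of `F`, and
• `τ'(e)` has negative imaginary part for every `τ' ∈ Φ_μ`.  It is clear by Remark 4.4 that `ε` is `μ`-admissible
if and only if `−ε` is `μ^c`-admissible."  Here (§4 preamble, chunk p0018 L5–17; TeX ll. 1880–1890) `E/F` is a CM
extension with nontrivial involution `c`, "`E^−` the subgroup of `E` consisting of `e` satisfying `e + e^c = 0`",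
`Φ_μ` is the CM type of the weight-one conjugate-symplectic character `μ` (Def. 4.3 (2)), and `Φ_{μ^c} = \bar Φ_μ`
(Remark 4.2: the archimedean components of `μ^c = μ ∘ c` are those of `μ` read through the conjugate embeddings).

WHAT IS HERE (the finite, algebraic part of Def. 4.12 — the ELEMENT `e`; the adèlic collection `ε = (e N E_v^×)_v`
it generates is not modelled):
* `IsAdmissibleElement E Φ e` — `e ∈ E^{×,−}` (`e ≠ 0`, `ē = −e` for Mathlib's `IsCMField.complexConj`) with
  `Im τ'(e) < 0` for every `τ'` in a set `Φ` of complex embeddings (for Liu: `Φ = Φ_μ`);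
* `isAdmissibleElement_conj_neg_iff` — the printed last sentence of Def. 4.12 on elements: `−e` is admissible for the
  conjugate set `\bar Φ = {τ' | \bar τ' ∈ Φ}` iff `e` is admissible for `Φ` (PROVED; it needs no hypothesis on `Φ`);
* `exists_isAdmissibleElement` — for every set `Φ` containing no pair of complex-conjugate embeddings (in
  particular every CM type `Φ_μ`) an admissible `e` EXISTS (PROVED).  The source takes this for granted (the
  direct sums of Prop. 4.13 / Thm. 4.18 / Cor. 4.20 run over the `μ`-admissible `ε`); the standard argument is weak
  approximation at the infinite places — here the tree's `Literature.NumberTheory.NumberFields.denseRange_embeddings`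
  (Mathlib `InfiniteAdeleRing.denseRange_algebraMap`): approximate the vector `(∓ i)_w` by `(w(x))_w` and take
  `e = x − x̄`;
* `isAdmissibleElement_gaussian` — a DECIDED instance (validation theorem V-C5.i of the lit-hodgefound Layer-C
  definitions tribunal, statement as in its probe file): over `E = ℚ(i) = ℚ(ζ₄)` (`CyclotomicField 4 ℚ`, CM by
  Mathlib's `IsCyclotomicExtension.Rat.isCMField`, `[E : ℚ] = φ(4) = 2`), the element `e = ζ₄` is admissible for
  `Φ = {τ}`, `τ` the embedding with `τ(ζ₄) = −i`: `ζ₄ ≠ 0`, `\bar ζ₄ = ζ₄⁻¹ = ζ₄³ = −ζ₄`, `Im τ(ζ₄) = −1 < 0` (PROVED).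

NOT here: automorphic characters, the collection `ε` at the finite places, `μ`-admissibility of a given `ε`
(these need adèlic carriers; the tree's typed skeleton `Literature.AlgebraicGeometry.Liu2021.LiuAlbaneseDatum`
carries the `μ`-admissible `(ε, χ)` as the bare type `Adm μ`).

## References

* [Liu2021] Y. Liu, Camb. J. Math. 9 (2021) 1–147 = arXiv:2102.11518 — Def. 4.12, Remark 4.2, Remark 4.4.
-/

noncomputable section

namespace Literature.AlgebraicGeometry.Liu2021

open NumberField NumberField.InfinitePlace NumberField.ComplexEmbedding
open scoped ComplexConjugate

variable (E : Type) [Field E] [NumberField E] [IsCMField E]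

/-- **[Liu2021, Def. 4.12], the element `e`.**  `IsAdmissibleElement E Φ e`: `e ∈ E^{×,−}` — `e ≠ 0` and
`ē = −e` (`ē = IsCMField.complexConj E e`, the nontrivial involution of the CM field `E` over `E⁺`) — and
"`τ'(e)` has negative imaginary part for every `τ' ∈ Φ`" (for Liu, `Φ = Φ_μ`, the CM type of `μ`).
[cite: Liu2021, Def. 4.12] -/
def IsAdmissibleElement (Φ : Set (E →+* ℂ)) (e : E) : Prop :=
  e ≠ 0 ∧ IsCMField.complexConj E e = -e ∧ ∀ τ' ∈ Φ, (τ' e).im < 0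

variable {E}

/-- Unfolding of `IsAdmissibleElement`. [cite: Liu2021, Def. 4.12] -/
theorem isAdmissibleElement_iff (Φ : Set (E →+* ℂ)) (e : E) :
    IsAdmissibleElement E Φ e ↔ e ≠ 0 ∧ IsCMField.complexConj E e = -e ∧ ∀ τ' ∈ Φ, (τ' e).im < 0 :=
  Iff.rfl

/-- **[Liu2021, Def. 4.12, last sentence] on elements**, AS PRINTED: "It is clear by Remark 4.4 that `ε` is
`μ`-admissible if and only if `−ε` is `μ^c`-admissible" — with `Φ_{μ^c} = \bar Φ_μ`: the element `−e` is admissible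
for the conjugate set `{τ' | \bar τ' ∈ Φ}` iff `e` is admissible for `Φ`.  (Our proof: `\bar τ'(−e) = −conj(τ'(e))`
has the imaginary part of `τ'(e)`.) [cite: Liu2021, Def. 4.12] -/
theorem isAdmissibleElement_conj_neg_iff (Φ : Set (E →+* ℂ)) (e : E) :
    IsAdmissibleElement E {τ' | conjugate τ' ∈ Φ} (-e) ↔ IsAdmissibleElement E Φ e := by
  simp only [isAdmissibleElement_iff, ne_eq, neg_eq_zero, map_neg, neg_inj, Set.mem_setOf_eq, map_neg,
    Complex.neg_im, neg_lt_zero]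
  refine and_congr_right fun _ => and_congr_right fun _ => ⟨fun h τ' hτ' => ?_, fun h τ' hτ' => ?_⟩
  · have h' := h (conjugate τ') (by simpa using hτ')
    rw [conjugate_coe_eq, Complex.conj_im] at h'
    linarith
  · have h' := h (conjugate τ') hτ'
    have : (τ' e).im = -((conjugate τ') e).im := by
      rw [conjugate_coe_eq, Complex.conj_im, neg_neg]
    rw [this]
    linarith

/-- From `dist u (−i) < 1` the imaginary part of `u` is negative (private helper). [folklore] -/
private theorem im_neg_of_dist_neg_I_lt_one {u : ℂ} (h : dist u (-Complex.I) < 1) : u.im < 0 := by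
  rw [Complex.dist_eq] at h
  have h1 : |(u - -Complex.I).im| ≤ ‖u - -Complex.I‖ := Complex.abs_im_le_norm _
  have h2 : (u - -Complex.I).im = u.im + 1 := by simp
  rw [h2] at h1
  have h3 := (abs_lt.mp (lt_of_le_of_lt h1 h)).2
  linarith

/-- From `dist u i < 1` the imaginary part of `u` is positive (private helper). [folklore] -/
private theorem im_pos_of_dist_I_lt_one {u : ℂ} (h : dist u Complex.I < 1) : 0 < u.im := by
  rw [Complex.dist_eq] at h
  have h1 : |(u - Complex.I).im| ≤ ‖u - Complex.I‖ := Complex.abs_im_le_norm _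
  have h2 : (u - Complex.I).im = u.im - 1 := by simp
  rw [h2] at h1
  have h3 := (abs_lt.mp (lt_of_le_of_lt h1 h)).1
  linarith

/-- **Admissible elements exist** (the existence implicit in [Liu2021] Def. 4.12 / the index sets of Prop. 4.13,
Thm. 4.18, Cor. 4.20): if `Φ` contains no pair of complex-conjugate embeddings — in particular if `Φ` is a CM
type, e.g. `Φ_μ` — there is `e ∈ E^{×,−}` with `Im τ'(e) < 0` for all `τ' ∈ Φ`.  Our proof, by weak approximation
at the infinite places (`Literature.NumberTheory.NumberFields.denseRange_embeddings`): choose `x ∈ E` with `w(x)`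
within distance `1` of `−i` when `w`'s distinguished embedding lies in `Φ` and of `+i` otherwise, and put
`e = x − x̄`, so that `τ'(e) = 2i·Im τ'(x)`. [cite: Liu2021, Def. 4.12] -/
theorem exists_isAdmissibleElement (Φ : Set (E →+* ℂ)) (hΦ : ∀ φ ∈ Φ, conjugate φ ∉ Φ) :
    ∃ e : E, IsAdmissibleElement E Φ e := by
  classical
  let z : InfinitePlace E → ℂ := fun w => if w.embedding ∈ Φ then -Complex.I else Complex.I
  have hz₁ : ∀ w : InfinitePlace E, w.embedding ∈ Φ → z w = -Complex.I := fun w hw => if_pos hw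
  have hz₂ : ∀ w : InfinitePlace E, w.embedding ∉ Φ → z w = Complex.I := fun w hw => if_neg hw
  have hd := Literature.NumberTheory.NumberFields.denseRange_embeddings E
  obtain ⟨x, hx⟩ := hd.exists_mem_open Metric.isOpen_ball ⟨z, Metric.mem_ball_self one_pos⟩
  rw [Metric.mem_ball, dist_pi_lt_iff one_pos] at hx
  -- the imaginary parts of the conjugates of `x`
  have hneg : ∀ φ ∈ Φ, (φ x).im < 0 := by
    intro φ hφ
    have hw := hx (InfinitePlace.mk φ)
    rcases embedding_mk_eq φ with h | h
    · have hmem : (InfinitePlace.mk φ).embedding ∈ Φ := by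
        rw [h]
        exact hφ
      rw [hz₁ _ hmem, h] at hw
      exact im_neg_of_dist_neg_I_lt_one hw
    · have hnot : (InfinitePlace.mk φ).embedding ∉ Φ := by
        rw [h]
        exact hΦ φ hφ
      rw [hz₂ _ hnot, h] at hw
      have hpos := im_pos_of_dist_I_lt_one hw
      rw [conjugate_coe_eq, Complex.conj_im] at hpos
      linarith
  have hne : ∀ w : InfinitePlace E, (w.embedding x).im ≠ 0 := by
    intro w
    have hw := hx w
    by_cases hmem : w.embedding ∈ Φ
    · rw [hz₁ w hmem] at hw
      exact (im_neg_of_dist_neg_I_lt_one hw).ne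
    · rw [hz₂ w hmem] at hw
      exact (im_pos_of_dist_I_lt_one hw).ne'
  -- the element `e = x - x̄`
  have him : ∀ φ : E →+* ℂ, (φ (x - IsCMField.complexConj E x)).im = 2 * (φ x).im := by
    intro φ
    rw [map_sub, IsCMField.complexEmbedding_complexConj, Complex.sub_im, Complex.conj_im]
    ring
  refine ⟨x - IsCMField.complexConj E x, ?_, ?_, ?_⟩
  · obtain ⟨w₀⟩ := (inferInstance : Nonempty (InfinitePlace E))
    intro h0
    have h1 := him w₀.embedding
    rw [h0, map_zero, Complex.zero_im] at h1
    exact hne w₀ (by linarith)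
  · rw [map_sub, IsCMField.complexConj_apply_apply, neg_sub]
  · intro τ' hτ'
    rw [him τ']
    have := hneg τ' hτ'
    linarith

/-- Specialisation to a CM type `Φ` of `E` in the tree's sense (`Literature.AlgebraicGeometry.Motives.CMType`:
`φ ∈ Φ ↔ \bar φ ∉ Φ`): an admissible element for `Φ` exists — the case `Φ = Φ_μ` of [Liu2021] Def. 4.12.
[cite: Liu2021, Def. 4.12] -/
theorem exists_isAdmissibleElement_of_cmType (Φ : Set (E →+* ℂ)) (hΦ : ∀ φ, φ ∈ Φ ↔ conjugate φ ∉ Φ) :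
    ∃ e : E, IsAdmissibleElement E Φ e :=
  exists_isAdmissibleElement Φ fun φ hφ => (hΦ φ).mp hφ

/-! ### A decided instance over the Gaussian field `ℚ(i) = ℚ(ζ₄)` -/

/-- **A decided admissible element over `ℚ(i)`** (instance of [Liu2021] Def. 4.12; validation theorem V-C5.i of
the lit-hodgefound Layer-C definitions tribunal, statement as in its probe file): for the CM field
`E = ℚ(ζ₄) = ℚ(i)` (`CyclotomicField 4 ℚ`, of degree `φ(4) = 2`), the element `e = ζ₄` and the one-element set
`Φ = {τ}`, `τ : E → ℂ` the embedding with `τ(ζ₄) = −i`, satisfy `IsAdmissibleElement E Φ e`: `ζ₄ ≠ 0`,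
`\bar ζ₄ = −ζ₄` (`\bar ζ₄ = ζ₄⁻¹ = ζ₄³` and `ζ₄² = −1`), and `Im τ(ζ₄) = −1 < 0`.  (Every embedding sends `ζ₄` to a
square root of `−1`, i.e. to `±i`; composing with complex conjugation if necessary gives `τ`.)
[cite: Liu2021, Def. 4.12] -/
theorem isAdmissibleElement_gaussian :
    ∃ (E : Type) (_ : Field E) (_ : NumberField E) (_ : IsCMField E) (Φ : Set (E →+* ℂ)) (e : E),
      Module.finrank ℚ E = 2 ∧ Φ.Nonempty ∧ IsAdmissibleElement E Φ e := by
  haveI : NeZero ((4 : ℕ) : ℚ) := ⟨by norm_num⟩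
  haveI hcyc : IsCyclotomicExtension {4} ℚ (CyclotomicField 4 ℚ) :=
    CyclotomicField.isCyclotomicExtension 4 ℚ
  haveI hCM : IsCMField (CyclotomicField 4 ℚ) :=
    IsCyclotomicExtension.Rat.isCMField (CyclotomicField 4 ℚ) (S := {4}) ⟨4, rfl, by norm_num⟩
  set ζ : CyclotomicField 4 ℚ := IsCyclotomicExtension.zeta 4 ℚ (CyclotomicField 4 ℚ)
  have hζ : IsPrimitiveRoot ζ 4 := IsCyclotomicExtension.zeta_spec 4 ℚ (CyclotomicField 4 ℚ)
  -- `ζ² = -1`: `ζ²` is a primitive square root of unity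
  have hζ2 : ζ ^ 2 = -1 := (hζ.pow (by norm_num) (by norm_num : 4 = 2 * 2)).eq_neg_one_of_two_right
  have hζ0 : ζ ≠ 0 := hζ.ne_zero (by norm_num)
  -- an embedding `τ` with `τ ζ = -i`: any embedding sends `ζ` to `±i`; conjugate it if necessary
  obtain ⟨τ, hτ⟩ : ∃ τ : CyclotomicField 4 ℚ →+* ℂ, τ ζ = -Complex.I := by
    obtain ⟨φ⟩ : Nonempty (CyclotomicField 4 ℚ →+* ℂ) := inferInstance
    have hφ : φ ζ ^ 2 = Complex.I ^ 2 := by rw [← map_pow, hζ2, map_neg, map_one, Complex.I_sq]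
    rcases sq_eq_sq_iff_eq_or_eq_neg.1 hφ with h | h
    · exact ⟨conjugate φ, by rw [conjugate_coe_eq, h, Complex.conj_I]⟩
    · exact ⟨φ, h⟩
  -- `\bar ζ = -ζ`, read through the embedding `τ`
  have hconj : IsCMField.complexConj (CyclotomicField 4 ℚ) ζ = -ζ := by
    apply τ.injective
    rw [IsCMField.complexEmbedding_complexConj, map_neg, hτ, map_neg, Complex.conj_I]
  refine ⟨CyclotomicField 4 ℚ, inferInstance, inferInstance, hCM, {τ}, ζ, ?_, Set.singleton_nonempty τ,
    hζ0, hconj, ?_⟩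
  · -- `[ℚ(ζ₄) : ℚ] = φ(4) = φ(2²) = 2`
    rw [IsCyclotomicExtension.finrank (n := 4) (CyclotomicField 4 ℚ)
      (Polynomial.cyclotomic.irreducible_rat (by norm_num))]
    show Nat.totient (2 ^ 2) = 2 ^ (2 - 1) * (2 - 1)
    exact Nat.totient_prime_pow Nat.prime_two two_pos
  · intro τ' hτ'
    rw [Set.mem_singleton_iff.1 hτ', hτ, Complex.neg_im, Complex.I_im]
    norm_num

end Literature.AlgebraicGeometry.Liu2021

end
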